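import Literature.Geometry.DiscreteGeometry.KissingPatterns

/-!
# `badCertificate_of_counts`: the soft no-match certificate of a BAD host site from two shell counts

Route `FrustratedLawDichotomy`, residual crux `AperiodicFrustratedLawGap` (E′), texture side; owed item `badCertificate_of_row` of r1713 (B),
COUNTING ROWS (coordination number ≠ 12).  The BAD-host input of (195) `…TextureFlipBad.not_gy_eighth_of_badTemplate` / of the LIFT is, per
template site `x₁`, the SOFT NO-MATCH CERTIFICATE

  `∀ dk ≥ 7/10, ∀ A, ¬ ((∀ u ∈ Pat, ∃ z ∈ a, dist (z − x₁) (dk•A u) ≤ dk/8 + σ + 2τ) ∧`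
  `                    (∀ z ∈ a, z ≠ x₁ → dist z x₁ + σ + 4τ ≤ 13/10·dk → ∃ u ∈ Pat, dist (z − x₁) (dk•A u) ≤ dk/8 + σ + 2τ))`

for `Pat` = fcc and hcp kissing patterns — a statement over ALL scales `dk` and ALL linear isometries `A`.  This file reduces it to FINITE
SHELL COUNTS of the template `a` around `x₁` (no rotation, no optimisation):

* `scale_window_of_softMatch` — a soft match pins the scale: `8/9·(d_a − σ − 2τ) ≤ dk ≤ 8/7·(d₁ + σ + 2τ)` (`d_a` a lower bound for the
  distances of the template points `z ≠ x₁` from `x₁`, `d₁` the distance bound of one template neighbour `z₁`);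
* `not_softMatch_of_counts` ★ — at a scale `dk ≥ 7/10` (slack `σ + 2τ < 1/5`), a soft match is impossible as soon as EITHER at most `11`
  template points `z ≠ x₁` lie in the annulus `7/8·dk − σ − 2τ ≤ dist z x₁ ≤ 9/8·dk + σ + 2τ` (the twelve pattern points, pairwise `≥ dk` apart,
  need twelve DISTINCT partners there: under-coordination, e.g. a vacancy shell of `11`), OR the template is `> 2(dk/8 + σ + 2τ)`-separated and at
  least `13` template points `z ≠ x₁` lie within `13/10·dk − σ − 4τ` of `x₁` (they would need thirteen distinct partners among twelve pattern
  points: over-coordination, e.g. the `8 + 6` shell of bcc once the annulus must hold twelve points);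
* `badCertificate_of_counts` ★ — the packaged certificate for fcc AND hcp (exactly the last two fields of the LIFT's `hB`), from the row
  hypothesis `hrow : ∀ dk ∈ [8/9·(d_a − σ − 2τ), 8/7·(d₁ + σ + 2τ)], (≤ 11 in the annulus) ∨ (separation ∧ ≥ 13 in the ball)` — for a concrete
  finite template a finite case split in `dk` (the counts are step functions of `dk` with breakpoints at the shell radii).

Counts are phrased WITHOUT `Finset.filter` (no decidability): "≤ 11" as a covering finset `t` with `t.card ≤ 11`, "≥ 13" as a sub-finset `t ⊆ a`
with `t.card = 13`.  NOT covered here (η-rows): twelve-coordinated but distorted shells (icosahedral-type); those need a metric certificate.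
Tree inputs BY NAME: `card_fcc/hcpKissingPattern`, `norm_eq_one_of_mem_fcc/hcpKissingPattern`, `one_le_dist_of_mem_fcc/hcpKissingPattern`.
-/

noncomputable section

namespace Summit.AtomisticToContinuum.Crystallization.Theorems.FrustratedLawDichotomyTextureBadRow

open Metric Set
open Literature.Geometry.DiscreteGeometry

/-- The norm of a scaled rotated unit pattern vector. [folklore] -/
theorem norm_smul_isometry_of_norm_one {A : EuclideanSpace ℝ (Fin 3) →ₗᵢ[ℝ] EuclideanSpace ℝ (Fin 3)} {u : EuclideanSpace ℝ (Fin 3)}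
    (hu : ‖u‖ = 1) {dk : ℝ} (hdk : 0 ≤ dk) : ‖dk • A u‖ = dk := by
  rw [norm_smul, A.norm_map, hu, mul_one, Real.norm_of_nonneg hdk]

/-- A template point softly matched to a scaled unit pattern vector lies in the annulus `[dk − s, dk + s]` around `x₁`. [folklore] -/
theorem annulus_of_softMatch {A : EuclideanSpace ℝ (Fin 3) →ₗᵢ[ℝ] EuclideanSpace ℝ (Fin 3)} {u z x₁ : EuclideanSpace ℝ (Fin 3)}
    (hu : ‖u‖ = 1) {dk s : ℝ} (hdk : 0 ≤ dk) (h : dist (z - x₁) (dk • A u) ≤ s) : dk - s ≤ dist z x₁ ∧ dist z x₁ ≤ dk + s := by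
  have h1 := abs_norm_sub_norm_le (z - x₁) (dk • A u)
  rw [norm_smul_isometry_of_norm_one hu hdk, ← dist_eq_norm, ← dist_eq_norm] at h1
  constructor <;> linarith [(abs_le.mp (h1.trans h)).1, (abs_le.mp (h1.trans h)).2]

/-- **The scale window.**  A soft match pins `dk`: `8/9·(d_a − σ − 2τ) ≤ dk ≤ 8/7·(d₁ + σ + 2τ)`. [folklore] -/
theorem scale_window_of_softMatch {a : Finset (EuclideanSpace ℝ (Fin 3))} {x₁ z₁ : EuclideanSpace ℝ (Fin 3)} {d_a d₁ σ τ dk : ℝ}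
    (hnn : ∀ z ∈ a, z ≠ x₁ → d_a ≤ dist z x₁) (hz₁ : z₁ ∈ a) (hz₁ne : z₁ ≠ x₁) (hz₁d : dist z₁ x₁ ≤ d₁)
    (hσ : 0 ≤ σ) (hdk : 7 / 10 ≤ dk) (hslack : σ + 2 * τ < 1 / 5)
    {Pat : Finset (EuclideanSpace ℝ (Fin 3))} (hne : Pat.Nonempty) (hnorm : ∀ u ∈ Pat, ‖u‖ = 1)
    {A : EuclideanSpace ℝ (Fin 3) →ₗᵢ[ℝ] EuclideanSpace ℝ (Fin 3)}
    (h1 : ∀ u ∈ Pat, ∃ z ∈ a, dist (z - x₁) (dk • A u) ≤ dk / 8 + σ + 2 * τ)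
    (h2 : ∀ z ∈ a, z ≠ x₁ → dist z x₁ + σ + 4 * τ ≤ 13 / 10 * dk → ∃ u ∈ Pat, dist (z - x₁) (dk • A u) ≤ dk / 8 + σ + 2 * τ) :
    8 / 9 * (d_a - σ - 2 * τ) ≤ dk ∧ dk ≤ 8 / 7 * (d₁ + σ + 2 * τ) := by
  have hdk0 : 0 ≤ dk := by linarith
  obtain ⟨u, hu⟩ := hne
  obtain ⟨z, hz, hzu⟩ := h1 u hu
  have hann := annulus_of_softMatch (hnorm u hu) hdk0 hzu
  have hzne : z ≠ x₁ := by
    intro h; rw [h, dist_self] at hann; linarith [hann.1]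
  have hlo := hnn z hz hzne
  refine ⟨by linarith [hann.2], ?_⟩
  by_cases hc : dist z₁ x₁ + σ + 4 * τ ≤ 13 / 10 * dk
  · obtain ⟨u', hu', hzu'⟩ := h2 z₁ hz₁ hz₁ne hc
    have h' := annulus_of_softMatch (hnorm u' hu') hdk0 hzu'
    linarith [h'.1]
  · have hc' := lt_of_not_ge hc
    nlinarith

/-- ★ **No soft match from two shell counts.**  See the module docstring. [folklore] -/
theorem not_softMatch_of_counts {a : Finset (EuclideanSpace ℝ (Fin 3))} {x₁ : EuclideanSpace ℝ (Fin 3)} {δa σ τ dk : ℝ}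
    (ha : ∀ z ∈ a, ∀ z' ∈ a, z ≠ z' → δa ≤ dist z z') (hdk : 7 / 10 ≤ dk) (hslack : σ + 2 * τ < 1 / 5)
    {Pat : Finset (EuclideanSpace ℝ (Fin 3))} (hcard : Pat.card = 12) (hnorm : ∀ u ∈ Pat, ‖u‖ = 1)
    (hsep : ∀ u ∈ Pat, ∀ u' ∈ Pat, u ≠ u' → 1 ≤ dist u u')
    (hrow : (∃ t : Finset (EuclideanSpace ℝ (Fin 3)), t.card ≤ 11 ∧
        ∀ z ∈ a, z ≠ x₁ → 7 / 8 * dk - σ - 2 * τ ≤ dist z x₁ → dist z x₁ ≤ 9 / 8 * dk + σ + 2 * τ → z ∈ t) ∨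
      (2 * (dk / 8 + σ + 2 * τ) < δa ∧ ∃ t : Finset (EuclideanSpace ℝ (Fin 3)), t ⊆ a ∧ t.card = 13 ∧
        ∀ z ∈ t, z ≠ x₁ ∧ dist z x₁ ≤ 13 / 10 * dk - σ - 4 * τ))
    (A : EuclideanSpace ℝ (Fin 3) →ₗᵢ[ℝ] EuclideanSpace ℝ (Fin 3)) :
    ¬ ((∀ u ∈ Pat, ∃ z ∈ a, dist (z - x₁) (dk • A u) ≤ dk / 8 + σ + 2 * τ) ∧
        (∀ z ∈ a, z ≠ x₁ → dist z x₁ + σ + 4 * τ ≤ 13 / 10 * dk → ∃ u ∈ Pat, dist (z - x₁) (dk • A u) ≤ dk / 8 + σ + 2 * τ)) := by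
  rintro ⟨h1, h2⟩
  have hdk0 : 0 ≤ dk := by linarith
  -- two pattern vectors softly matched to the same point are `≤ 2s < dk` apart, but distinct ones are `≥ dk` apart
  have hPat : ∀ u ∈ Pat, ∀ u' ∈ Pat, ∀ w : EuclideanSpace ℝ (Fin 3), dist w (dk • A u) ≤ dk / 8 + σ + 2 * τ →
      dist w (dk • A u') ≤ dk / 8 + σ + 2 * τ → u = u' := by
    intro u hu u' hu' w hw hw'
    by_contra hne
    have h3 : dk ≤ dist (dk • A u) (dk • A u') := by
      rw [dist_smul₀, A.isometry.dist_eq, Real.norm_of_nonneg hdk0]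
      nlinarith [hsep u hu u' hu' hne]
    have h4 := dist_triangle_left (dk • A u) (dk • A u') w
    linarith
  rcases hrow with ⟨t, htc, ht⟩ | ⟨hδ, t, hta, htc, ht⟩
  · -- under-coordination: twelve pattern points need twelve distinct partners in the annulus
    choose! f hf using h1
    have hmaps : ∀ u ∈ Pat, f u ∈ t := by
      intro u hu
      have hann := annulus_of_softMatch (hnorm u hu) hdk0 (hf u hu).2
      have hzne : f u ≠ x₁ := by
        intro h; rw [h, dist_self] at hann; linarith [hann.1]
      exact ht (f u) (hf u hu).1 hzne (by linarith [hann.1]) (by linarith [hann.2])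
    have hinj : Set.InjOn f ↑Pat := by
      intro u hu u' hu' huu
      exact hPat u hu u' hu' (f u - x₁) (hf u hu).2 (by rw [huu]; exact (hf u' hu').2)
    have hle : Pat.card ≤ t.card := Finset.card_le_card_of_injOn f (by intro u hu; exact hmaps u hu) hinj
    omega
  · -- over-coordination: thirteen separated template points would need thirteen distinct partners among twelve pattern points
    have h2' : ∀ z ∈ t, ∃ u ∈ Pat, dist (z - x₁) (dk • A u) ≤ dk / 8 + σ + 2 * τ := by
      intro z hz
      exact h2 z (hta hz) (ht z hz).1 (by linarith [(ht z hz).2])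
    choose! g hg using h2'
    have hinj : Set.InjOn g ↑t := by
      intro z hz z' hz' hzz
      by_contra hne
      have h3 := ha z (hta hz) z' (hta hz') hne
      have h4 : dist z z' = dist (z - x₁) (z' - x₁) := by rw [dist_sub_right]
      have h5 := dist_triangle_right (z - x₁) (z' - x₁) (dk • A (g z))
      have h6 := (hg z hz).2
      have h7 := (hg z' hz').2
      rw [← hzz] at h7
      linarith
    have hle : t.card ≤ Pat.card := Finset.card_le_card_of_injOn g (by intro z hz; exact (hg z hz).1) hinj
    omega

/-- ★ **`badCertificate_of_counts`** — the fcc AND hcp soft no-match certificates of a template site (the last two fields of the LIFT's BAD-host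
datum `hB`) from the COUNTING ROW `hrow` on the pinned scale window.  Template data: `δa`-separation, the lower bound `d_a` for the distances
of the template points `z ≠ x₁` from `x₁`, one neighbour `z₁` at distance `≤ d₁`; slack `0 ≤ σ`, `σ + 2τ < 1/5`. [folklore] -/
theorem badCertificate_of_counts {a : Finset (EuclideanSpace ℝ (Fin 3))} {x₁ z₁ : EuclideanSpace ℝ (Fin 3)} {δa d_a d₁ σ τ : ℝ}
    (ha : ∀ z ∈ a, ∀ z' ∈ a, z ≠ z' → δa ≤ dist z z')
    (hnn : ∀ z ∈ a, z ≠ x₁ → d_a ≤ dist z x₁) (hz₁ : z₁ ∈ a) (hz₁ne : z₁ ≠ x₁) (hz₁d : dist z₁ x₁ ≤ d₁)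
    (hσ : 0 ≤ σ) (hslack : σ + 2 * τ < 1 / 5)
    (hrow : ∀ dk : ℝ, (7 : ℝ) / 10 ≤ dk → 8 / 9 * (d_a - σ - 2 * τ) ≤ dk → dk ≤ 8 / 7 * (d₁ + σ + 2 * τ) →
      (∃ t : Finset (EuclideanSpace ℝ (Fin 3)), t.card ≤ 11 ∧
          ∀ z ∈ a, z ≠ x₁ → 7 / 8 * dk - σ - 2 * τ ≤ dist z x₁ → dist z x₁ ≤ 9 / 8 * dk + σ + 2 * τ → z ∈ t) ∨
        (2 * (dk / 8 + σ + 2 * τ) < δa ∧ ∃ t : Finset (EuclideanSpace ℝ (Fin 3)), t ⊆ a ∧ t.card = 13 ∧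
          ∀ z ∈ t, z ≠ x₁ ∧ dist z x₁ ≤ 13 / 10 * dk - σ - 4 * τ)) :
    (∀ dk : ℝ, (7 : ℝ) / 10 ≤ dk → ∀ A : EuclideanSpace ℝ (Fin 3) →ₗᵢ[ℝ] EuclideanSpace ℝ (Fin 3),
      ¬ ((∀ u ∈ fccKissingPattern, ∃ z ∈ a, dist (z - x₁) (dk • A u) ≤ dk / 8 + σ + 2 * τ) ∧
          (∀ z ∈ a, z ≠ x₁ → dist z x₁ + σ + 4 * τ ≤ 13 / 10 * dk →
            ∃ u ∈ fccKissingPattern, dist (z - x₁) (dk • A u) ≤ dk / 8 + σ + 2 * τ))) ∧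
    (∀ dk : ℝ, (7 : ℝ) / 10 ≤ dk → ∀ A : EuclideanSpace ℝ (Fin 3) →ₗᵢ[ℝ] EuclideanSpace ℝ (Fin 3),
      ¬ ((∀ u ∈ hcpKissingPattern, ∃ z ∈ a, dist (z - x₁) (dk • A u) ≤ dk / 8 + σ + 2 * τ) ∧
          (∀ z ∈ a, z ≠ x₁ → dist z x₁ + σ + 4 * τ ≤ 13 / 10 * dk →
            ∃ u ∈ hcpKissingPattern, dist (z - x₁) (dk • A u) ≤ dk / 8 + σ + 2 * τ))) := by
  have hfne : fccKissingPattern.Nonempty := Finset.card_pos.mp (by rw [card_fccKissingPattern]; norm_num)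
  have hhne : hcpKissingPattern.Nonempty := Finset.card_pos.mp (by rw [card_hcpKissingPattern]; norm_num)
  refine ⟨fun dk hdk A h => ?_, fun dk hdk A h => ?_⟩
  · have hw := scale_window_of_softMatch hnn hz₁ hz₁ne hz₁d hσ hdk hslack hfne (fun u hu => norm_eq_one_of_mem_fccKissingPattern hu)
      h.1 h.2
    exact not_softMatch_of_counts ha hdk hslack card_fccKissingPattern (fun u hu => norm_eq_one_of_mem_fccKissingPattern hu)
      (fun u hu u' hu' hne => one_le_dist_of_mem_fccKissingPattern hu hu' hne) (hrow dk hdk hw.1 hw.2) A h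
  · have hw := scale_window_of_softMatch hnn hz₁ hz₁ne hz₁d hσ hdk hslack hhne (fun u hu => norm_eq_one_of_mem_hcpKissingPattern hu)
      h.1 h.2
    exact not_softMatch_of_counts ha hdk hslack card_hcpKissingPattern (fun u hu => norm_eq_one_of_mem_hcpKissingPattern hu)
      (fun u hu u' hu' hne => one_le_dist_of_mem_hcpKissingPattern hu hu' hne) (hrow dk hdk hw.1 hw.2) A h

end Summit.AtomisticToContinuum.Crystallization.Theorems.FrustratedLawDichotomyTextureBadRow

end
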